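import Literature.AlgebraicGeometry.Resolution.LogRegularRefinementLocal
import HarnessLib

/-!
# The absorbed chart `P × ℕ^d` of a log regular local ring (Kato 1994, (3.2))

`Literature/AlgebraicGeometry/Resolution/LogRegularAbsorbedChart.lean`. In Kato's setting
(K. Kato, *Toric singularities*, Amer. J. Math. 116 (1994), Def. (2.1), (3.2)) a log regular
local ring `A` with chart `φ : P → A` has `A/I(φ)` regular of dimension `d`,
`I(φ) = (φ(P ∖ 0))`, and the structure theorem reads `𝒪̂ ≅ R[[P]][[T₁,…,T_d]]/(θ)` — i.e. the
`d` regular parameters behave like `d` extra free generators of the monoid. This file makes that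
precise on the level of charts: with `t₁,…,t_d ∈ 𝔪_A`, the monoid `P̃ = P × ℕ^d ⊆ ℕ^{M+d}`
with chart `φ̃(p, e) = φ(p) t^e`, and the extension `c̃ = c × id : P̃ → ℕ^{N+d}` of a refinement
`c : P → ℕ^N`. If `𝔪_A = I(φ) + (t)` then `φ̃(P̃ ∖ 0)` generates `𝔪_A` (the `d = 0` normal form
used in `LogRegularRefinement*.lean`).

* `absorbProj₁`, `absorbProj₂`, `absorbGlue` — coordinates `ℕ^{M+d} = ℕ^M × ℕ^d`;
* `absorbMonoid P d` (`absorbMonoid_fg`), `absorbChart φ t` (`absorbChart_add`,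
  `absorbChart_mem_maximalIdeal`, `maximalIdeal_le_span_absorbChart`), `absorbMap c`
  (`absorbMap_add`, `absorbMap_ne_zero`, `absorbMap_finite_fibre`).

References: [Kato1994] K. Kato, Toric singularities, Amer. J. Math. 116 (1994), (2.1), (3.2), (10.3).
-/

noncomputable section

open IsLocalRing Literature.RingTheory.MvPowerSeries
  Literature.RingTheory.MvPowerSeries.monoidPowerSeries

namespace Literature.AlgebraicGeometry.Resolution

namespace LogRegularCompleteStructure

universe u

/-! ### Coordinates on `ℕ^{M+d}` -/

section Coordinates

variable {M d : ℕ}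

/-- First `M` coordinates of an exponent vector in `ℕ^{M+d}`. [cite: Kato1994, (3.2)] -/
def absorbProj₁ (M d : ℕ) : (Fin (M + d) →₀ ℕ) →+ (Fin M →₀ ℕ) :=
  Finsupp.comapDomain.addMonoidHom (Fin.castAdd_injective M d)

/-- Last `d` coordinates of an exponent vector in `ℕ^{M+d}`. [cite: Kato1994, (3.2)] -/
def absorbProj₂ (M d : ℕ) : (Fin (M + d) →₀ ℕ) →+ (Fin d →₀ ℕ) :=
  Finsupp.comapDomain.addMonoidHom (Fin.natAdd_injective d M)

/-- Gluing `ℕ^M × ℕ^d → ℕ^{M+d}`. [cite: Kato1994, (3.2)] -/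
def absorbGlue (M d : ℕ) : (Fin M →₀ ℕ) × (Fin d →₀ ℕ) →+ (Fin (M + d) →₀ ℕ) :=
  (Finsupp.mapDomain.addMonoidHom (Fin.castAdd d)).coprod
    (Finsupp.mapDomain.addMonoidHom (Fin.natAdd M))

/-- Bookkeeping for the absorbed chart `P × ℕ^d`. [cite: Kato1994, (3.2)] -/
@[simp] theorem absorbProj₁_apply (w : Fin (M + d) →₀ ℕ) (i : Fin M) :
    absorbProj₁ M d w i = w (Fin.castAdd d i) := rfl

/-- Bookkeeping for the absorbed chart `P × ℕ^d`. [cite: Kato1994, (3.2)] -/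
@[simp] theorem absorbProj₂_apply (w : Fin (M + d) →₀ ℕ) (k : Fin d) :
    absorbProj₂ M d w k = w (Fin.natAdd M k) := rfl

/-- Values of the glued vector on the first block. [cite: Kato1994, (3.2)] -/
@[simp] theorem absorbGlue_apply_castAdd (p : Fin M →₀ ℕ) (e : Fin d →₀ ℕ) (i : Fin M) :
    absorbGlue M d (p, e) (Fin.castAdd d i) = p i := by
  classical
  simp only [absorbGlue, AddMonoidHom.coprod_apply, Finsupp.mapDomain.addMonoidHom_apply,
    Finsupp.add_apply]
  rw [Finsupp.mapDomain_apply (Fin.castAdd_injective M d), Finsupp.mapDomain_notin_range, add_zero]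
  rintro ⟨k, hk⟩
  exact absurd (congrArg Fin.val hk) (by simp [Fin.natAdd, Fin.castAdd]; omega)

/-- Values of the glued vector on the second block. [cite: Kato1994, (3.2)] -/
@[simp] theorem absorbGlue_apply_natAdd (p : Fin M →₀ ℕ) (e : Fin d →₀ ℕ) (k : Fin d) :
    absorbGlue M d (p, e) (Fin.natAdd M k) = e k := by
  classical
  simp only [absorbGlue, AddMonoidHom.coprod_apply, Finsupp.mapDomain.addMonoidHom_apply,
    Finsupp.add_apply]
  rw [Finsupp.mapDomain_apply (Fin.natAdd_injective d M), Finsupp.mapDomain_notin_range, zero_add]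
  rintro ⟨i, hi⟩
  exact absurd (congrArg Fin.val hi) (by simp [Fin.natAdd, Fin.castAdd]; omega)

/-- Bookkeeping for the absorbed chart `P × ℕ^d`. [cite: Kato1994, (3.2)] -/
@[simp] theorem absorbProj₁_absorbGlue (p : Fin M →₀ ℕ) (e : Fin d →₀ ℕ) :
    absorbProj₁ M d (absorbGlue M d (p, e)) = p := by
  ext i; rw [absorbProj₁_apply, absorbGlue_apply_castAdd]

/-- Bookkeeping for the absorbed chart `P × ℕ^d`. [cite: Kato1994, (3.2)] -/
@[simp] theorem absorbProj₂_absorbGlue (p : Fin M →₀ ℕ) (e : Fin d →₀ ℕ) :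
    absorbProj₂ M d (absorbGlue M d (p, e)) = e := by
  ext k; rw [absorbProj₂_apply, absorbGlue_apply_natAdd]

/-- Every exponent vector is glued from its two blocks. [cite: Kato1994, (3.2)] -/
theorem absorbGlue_proj (w : Fin (M + d) →₀ ℕ) :
    absorbGlue M d (absorbProj₁ M d w, absorbProj₂ M d w) = w := by
  ext j
  induction j using Fin.addCases with
  | left i => rw [absorbGlue_apply_castAdd, absorbProj₁_apply]
  | right k => rw [absorbGlue_apply_natAdd, absorbProj₂_apply]

/-- Bookkeeping for the absorbed chart `P × ℕ^d`. [cite: Kato1994, (3.2)] -/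
theorem eq_zero_of_proj_eq_zero {w : Fin (M + d) →₀ ℕ} (h₁ : absorbProj₁ M d w = 0)
    (h₂ : absorbProj₂ M d w = 0) : w = 0 := by
  rw [← absorbGlue_proj w, h₁, h₂, ← Prod.zero_eq_mk, map_zero]

end Coordinates

/-! ### The absorbed monoid, chart and refinement -/

section Absorb

variable {A : Type u} [CommRing A] {M N d : ℕ}

/-- **The absorbed monoid** `P̃ = P × ℕ^d ⊆ ℕ^{M+d}`. [cite: Kato1994, (3.2)] -/
def absorbMonoid (P : AddSubmonoid (Fin M →₀ ℕ)) (d : ℕ) : AddSubmonoid (Fin (M + d) →₀ ℕ) :=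
  P.comap (absorbProj₁ M d)

/-- Bookkeeping for the absorbed chart `P × ℕ^d`. [cite: Kato1994, (3.2)] -/
@[simp] theorem mem_absorbMonoid {P : AddSubmonoid (Fin M →₀ ℕ)} {w : Fin (M + d) →₀ ℕ} :
    w ∈ absorbMonoid P d ↔ absorbProj₁ M d w ∈ P := Iff.rfl

/-- Bookkeeping for the absorbed chart `P × ℕ^d`. [cite: Kato1994, (3.2)] -/
theorem absorbGlue_mem {P : AddSubmonoid (Fin M →₀ ℕ)} {p : Fin M →₀ ℕ} (hp : p ∈ P)
    (e : Fin d →₀ ℕ) : absorbGlue M d (p, e) ∈ absorbMonoid P d := by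
  rw [mem_absorbMonoid, absorbProj₁_absorbGlue]; exact hp

/-- `P̃` is finitely generated when `P` is. [cite: Kato1994, (3.2)] -/
theorem absorbMonoid_fg {P : AddSubmonoid (Fin M →₀ ℕ)} (hP : P.FG) : (absorbMonoid P d).FG := by
  classical
  obtain ⟨S, hS⟩ := hP
  refine ⟨S.image (fun p => absorbGlue M d (p, 0)) ∪
    Finset.univ.image (fun k : Fin d => absorbGlue M d (0, Finsupp.single k 1)), ?_⟩
  refine le_antisymm (AddSubmonoid.closure_le.2 ?_) fun w hw => ?_
  · rintro w hw
    simp only [Finset.coe_union, Finset.coe_image, Finset.coe_univ, Set.image_univ, Set.mem_union,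
      Set.mem_image, Set.mem_range] at hw
    rcases hw with ⟨p, hp, rfl⟩ | ⟨k, rfl⟩
    · exact absorbGlue_mem (hS ▸ AddSubmonoid.subset_closure hp) 0
    · exact absorbGlue_mem (zero_mem P) _
  · rw [← absorbGlue_proj w, show (absorbProj₁ M d w, absorbProj₂ M d w) =
      (absorbProj₁ M d w, 0) + (0, absorbProj₂ M d w) by simp, map_add]
    refine add_mem ?_ ?_
    · -- the `P`-part: image of the closure of `S` under `p ↦ glue (p, 0)`
      have hmem : absorbProj₁ M d w ∈ AddSubmonoid.closure (S : Set (Fin M →₀ ℕ)) := hS ▸ hw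
      have hmap := AddSubmonoid.mem_map_of_mem
        ((absorbGlue M d).comp (AddMonoidHom.inl (Fin M →₀ ℕ) (Fin d →₀ ℕ))) hmem
      rw [AddMonoidHom.map_mclosure] at hmap
      refine AddSubmonoid.closure_mono ?_ hmap
      rintro _ ⟨p, hp, rfl⟩
      simp only [Finset.coe_union, Finset.coe_image, Set.mem_union, Set.mem_image]
      exact Or.inl ⟨p, hp, rfl⟩
    · -- the `ℕ^d`-part: induction on the exponent vector
      have key : ∀ e : Fin d →₀ ℕ, absorbGlue M d (0, e) ∈ AddSubmonoid.closure
          ((S.image (fun p => absorbGlue M d (p, 0)) ∪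
            Finset.univ.image (fun k : Fin d => absorbGlue M d (0, Finsupp.single k 1)) :
              Finset (Fin (M + d) →₀ ℕ)) : Set (Fin (M + d) →₀ ℕ)) := by
        intro e
        induction e using Finsupp.induction with
        | zero => rw [← Prod.zero_eq_mk, map_zero]; exact zero_mem _
        | single_add k n e _ _ ih =>
          have hsplit : ((0 : Fin M →₀ ℕ), Finsupp.single k n + e) =
              n • ((0 : Fin M →₀ ℕ), Finsupp.single k 1) + (0, e) := by
            ext i
            · simp
            · simp [Finsupp.smul_single]
          rw [hsplit, map_add, map_nsmul]
          refine add_mem (AddSubmonoid.nsmul_mem _ (AddSubmonoid.subset_closure ?_) _) ih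
          simp only [Finset.coe_union, Finset.coe_image, Finset.coe_univ, Set.image_univ,
            Set.mem_union, Set.mem_range]
          exact Or.inr ⟨k, rfl⟩
      exact key _

variable [IsLocalRing A]

/-- **The absorbed chart** `φ̃(w) = φ(w₁) · t^{w₂}`. [cite: Kato1994, (3.2)] -/
def absorbChart (φ : (Fin M →₀ ℕ) → A) (t : Fin d → A) (w : Fin (M + d) →₀ ℕ) : A :=
  φ (absorbProj₁ M d w) * (absorbProj₂ M d w).prod fun k n => t k ^ n

omit [IsLocalRing A] in
/-- Bookkeeping for the absorbed chart `P × ℕ^d`. [cite: Kato1994, (3.2)] -/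
theorem absorbChart_zero {φ : (Fin M →₀ ℕ) → A} (hφ0 : φ 0 = 1) (t : Fin d → A) :
    absorbChart φ t 0 = 1 := by
  rw [absorbChart, map_zero, map_zero, hφ0, Finsupp.prod_zero_index, one_mul]

omit [IsLocalRing A] in
/-- Bookkeeping for the absorbed chart `P × ℕ^d`. [cite: Kato1994, (3.2)] -/
theorem absorbChart_add {P : AddSubmonoid (Fin M →₀ ℕ)} {φ : (Fin M →₀ ℕ) → A}
    (hφadd : ∀ a ∈ P, ∀ b ∈ P, φ (a + b) = φ a * φ b) (t : Fin d → A) :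
    ∀ a ∈ absorbMonoid P d, ∀ b ∈ absorbMonoid P d,
      absorbChart φ t (a + b) = absorbChart φ t a * absorbChart φ t b := by
  classical
  intro a ha b hb
  rw [absorbChart, absorbChart, absorbChart, map_add, map_add, hφadd _ ha _ hb,
    Finsupp.prod_add_index']
  · ring
  · intro k; exact pow_zero _
  · intro k m n; exact pow_add _ _ _

omit [IsLocalRing A] in
/-- Bookkeeping for the absorbed chart `P × ℕ^d`. [cite: Kato1994, (3.2)] -/
theorem absorbChart_absorbGlue_zero (φ : (Fin M →₀ ℕ) → A) (t : Fin d → A) (p : Fin M →₀ ℕ) :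
    absorbChart φ t (absorbGlue M d (p, 0)) = φ p := by
  rw [absorbChart, absorbProj₁_absorbGlue, absorbProj₂_absorbGlue, Finsupp.prod_zero_index, mul_one]

omit [IsLocalRing A] in
/-- Bookkeeping for the absorbed chart `P × ℕ^d`. [cite: Kato1994, (3.2)] -/
theorem absorbChart_absorbGlue_single {φ : (Fin M →₀ ℕ) → A} (hφ0 : φ 0 = 1) (t : Fin d → A)
    (k : Fin d) : absorbChart φ t (absorbGlue M d (0, Finsupp.single k 1)) = t k := by
  rw [absorbChart, absorbProj₁_absorbGlue, absorbProj₂_absorbGlue, hφ0, one_mul,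
    Finsupp.prod_single_index (h := fun k n => t k ^ n) (pow_zero _), pow_one]

/-- Bookkeeping for the absorbed chart `P × ℕ^d`. [cite: Kato1994, (3.2)] -/
theorem absorbChart_mem_maximalIdeal {P : AddSubmonoid (Fin M →₀ ℕ)} {φ : (Fin M →₀ ℕ) → A}
    (hφm : ∀ p ∈ P, p ≠ 0 → φ p ∈ maximalIdeal A) {t : Fin d → A}
    (ht : ∀ k, t k ∈ maximalIdeal A) :
    ∀ w ∈ absorbMonoid P d, w ≠ 0 → absorbChart φ t w ∈ maximalIdeal A := by
  classical
  intro w hw hw0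
  rw [absorbChart]
  by_cases h1 : absorbProj₁ M d w = 0
  · have h2 : absorbProj₂ M d w ≠ 0 := fun h2 => hw0 (eq_zero_of_proj_eq_zero h1 h2)
    obtain ⟨k, hk⟩ := Finsupp.support_nonempty_iff.2 h2
    refine Ideal.mul_mem_left _ _ ?_
    rw [Finsupp.prod, ← Finset.mul_prod_erase _ _ hk]
    refine Ideal.mul_mem_right _ _ (Ideal.pow_mem_of_mem _ (ht k) _ ?_)
    exact Nat.pos_of_ne_zero (Finsupp.mem_support_iff.1 hk)
  · exact Ideal.mul_mem_right _ _ (hφm _ hw h1)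

/-- `𝔪_A = I(φ) + (t)` makes the absorbed chart generate `𝔪_A`. [cite: Kato1994, (3.2)] -/
theorem maximalIdeal_le_span_absorbChart {P : AddSubmonoid (Fin M →₀ ℕ)} {φ : (Fin M →₀ ℕ) → A}
    (hφ0 : φ 0 = 1) {t : Fin d → A}
    (hgen : maximalIdeal A ≤ Ideal.span (φ '' {p | p ∈ P ∧ p ≠ 0}) ⊔ Ideal.span (Set.range t)) :
    maximalIdeal A ≤ Ideal.span (absorbChart φ t '' {w | w ∈ absorbMonoid P d ∧ w ≠ 0}) := by
  refine hgen.trans (sup_le (Ideal.span_mono ?_) (Ideal.span_le.2 ?_))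
  · rintro _ ⟨p, ⟨hp, hp0⟩, rfl⟩
    refine ⟨absorbGlue M d (p, 0), ⟨absorbGlue_mem hp 0, fun h => hp0 ?_⟩,
      absorbChart_absorbGlue_zero φ t p⟩
    rw [← absorbProj₁_absorbGlue (d := d) p 0, h, map_zero]
  · rintro _ ⟨k, rfl⟩
    by_cases htk : t k = 0
    · rw [htk]; exact Ideal.zero_mem _
    refine Ideal.subset_span ⟨absorbGlue M d (0, Finsupp.single k 1), ⟨absorbGlue_mem (zero_mem P) _,
      fun h => ?_⟩, absorbChart_absorbGlue_single hφ0 t k⟩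
    have h1 := absorbProj₂_absorbGlue (M := M) (0 : Fin M →₀ ℕ) (Finsupp.single k 1)
    rw [h, map_zero] at h1
    have h2 := Finsupp.ext_iff.1 h1 k
    rw [Finsupp.zero_apply, Finsupp.single_eq_same] at h2
    exact one_ne_zero h2.symm

omit [IsLocalRing A] in
/-- **The absorbed refinement** `c̃(w) = (c(w₁), w₂) ∈ ℕ^{N+d}`. [cite: Kato1994, (10.3)] -/
def absorbMap (c : (Fin M →₀ ℕ) → (Fin N →₀ ℕ)) (w : Fin (M + d) →₀ ℕ) : Fin (N + d) →₀ ℕ :=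
  absorbGlue N d (c (absorbProj₁ M d w), absorbProj₂ M d w)

omit [IsLocalRing A] in
/-- Bookkeeping for the absorbed chart `P × ℕ^d`. [cite: Kato1994, (3.2)] -/
theorem absorbMap_zero {c : (Fin M →₀ ℕ) → (Fin N →₀ ℕ)} (hc0 : c 0 = 0) :
    absorbMap (d := d) c 0 = 0 := by
  rw [absorbMap, map_zero, map_zero, hc0, ← Prod.zero_eq_mk, map_zero]

omit [IsLocalRing A] in
/-- Bookkeeping for the absorbed chart `P × ℕ^d`. [cite: Kato1994, (3.2)] -/
theorem absorbMap_add {P : AddSubmonoid (Fin M →₀ ℕ)} {c : (Fin M →₀ ℕ) → (Fin N →₀ ℕ)}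
    (hadd : ∀ a ∈ P, ∀ b ∈ P, c (a + b) = c a + c b) :
    ∀ a ∈ absorbMonoid P d, ∀ b ∈ absorbMonoid P d,
      absorbMap c (a + b) = absorbMap c a + absorbMap c b := by
  intro a ha b hb
  simp only [absorbMap, map_add, hadd _ ha _ hb]
  rw [← Prod.mk_add_mk, map_add]

omit [IsLocalRing A] in
/-- Bookkeeping for the absorbed chart `P × ℕ^d`. [cite: Kato1994, (3.2)] -/
theorem absorbMap_ne_zero {P : AddSubmonoid (Fin M →₀ ℕ)} {c : (Fin M →₀ ℕ) → (Fin N →₀ ℕ)}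
    (hc : ∀ p ∈ P, p ≠ 0 → c p ≠ 0) :
    ∀ w ∈ absorbMonoid P d, w ≠ 0 → absorbMap c w ≠ 0 := by
  intro w hw hw0 h
  have h1 : c (absorbProj₁ M d w) = 0 := by
    rw [← absorbProj₁_absorbGlue (d := d) (c (absorbProj₁ M d w)) (absorbProj₂ M d w)]
    show absorbProj₁ N d (absorbMap c w) = 0
    rw [h, map_zero]
  have h2 : absorbProj₂ M d w = 0 := by
    rw [← absorbProj₂_absorbGlue (M := N) (c (absorbProj₁ M d w)) (absorbProj₂ M d w)]
    show absorbProj₂ N d (absorbMap c w) = 0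
    rw [h, map_zero]
  by_cases hp : absorbProj₁ M d w = 0
  · exact hw0 (eq_zero_of_proj_eq_zero hp h2)
  · exact hc _ hw hp h1

omit [IsLocalRing A] in
/-- Finite fibres are preserved by absorption. [cite: Kato1994, (10.3)] -/
theorem absorbMap_finite_fibre {P : AddSubmonoid (Fin M →₀ ℕ)} {c : (Fin M →₀ ℕ) → (Fin N →₀ ℕ)}
    (hfin : ∀ e : Fin N →₀ ℕ, {p : Fin M →₀ ℕ | p ∈ P ∧ c p = e}.Finite) (e : Fin (N + d) →₀ ℕ) :
    {w : Fin (M + d) →₀ ℕ | w ∈ absorbMonoid P d ∧ absorbMap c w = e}.Finite := by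
  refine ((hfin (absorbProj₁ N d e)).image fun p => absorbGlue M d (p, absorbProj₂ N d e)).subset ?_
  rintro w ⟨hw, hwe⟩
  refine ⟨absorbProj₁ M d w, ⟨hw, ?_⟩, ?_⟩
  · rw [← hwe, absorbMap, absorbProj₁_absorbGlue]
  · have h2 : absorbProj₂ N d e = absorbProj₂ M d w := by rw [← hwe, absorbMap, absorbProj₂_absorbGlue]
    show absorbGlue M d (absorbProj₁ M d w, absorbProj₂ N d e) = w
    rw [h2, absorbGlue_proj]

end Absorb


end LogRegularCompleteStructure

end Literature.AlgebraicGeometry.Resolution
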